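import Literature.Geometry.Symplectic.SteinCriticalValuePerturbation
import Literature.Geometry.Symplectic.SteinMorseIndex
import Literature.Geometry.Symplectic.SteinDomainShrinking
import Literature.Topology.FourManifolds.ImmersionOrientation
import HarnessLib

/-!
# A regular level separating the index-`2` critical point of a Stein `(1,1,1)`-handlebody

Topic `Literature/Geometry/Symplectic`; brick **F1a** of the design of
`stub_upsideDownLegendrianDual` (crux `stmt-SmoothPoincare4-3546`, line
`property-r-mazur-halves`): to turn the Stein–Mazur half of a bisection upside down one needs
a *regular level `c` of the `J`-convex Morse function `φ` of the Stein domain `(W, J, φ)`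
separating the index-`2` critical point (above `c`) from the critical points of index `0`
and `1` (below `c`)*.  When the index-`1` and index-`2` critical values coincide (allowed by
`IsMorse`) this needs a perturbation of `φ`, done **keeping `J`, strict `J`-convexity and the
germ of `φ` along `∂W`** by `SteinStructure.exists_perturb_criticalValue`
(`SteinCriticalValuePerturbation.lean`: Milnor 1965, Lemma 2.8 with the `C²`-openness of
`J`-convexity, Cieliebak–Eliashberg 2012, §3.2, as an extra threshold).

Contents (everything **proved**; no definition, no named fact):

* `SteinStructure.exists_eq_of_levi_pos` — repackaging: a smooth strictly `S.J`-convex `g`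
  equal to `S.φ` near `∂W` and `< max S.φ` inside is `S'.φ` for a Stein structure `S'` with
  `S'.J = S.J` and `max S'.φ = max S.φ`;
* `SteinStructure.exists_perturb_criticalValue` — Milnor's Lemma 2.8 for Stein structures:
  one critical value of the Morse `S.φ` moved up by less than `η`, off a finite set, keeping
  `J`, the boundary germ, the maximum, the critical points and their indices
  (`exists_perturb_criticalValue_levi` of `SteinCriticalValuePerturbation.lean`, repackaged);
* `SteinStructure.exists_perturb_separating_level` — for `S.φ` Morse with exactly one critical
  point of each index `0, 1, 2` and the index-`1` value not above the index-`2` value, a Stein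
  structure `S'` with `S'.J = S.J`, `S'.φ = S.φ` on an open set containing `∂W`, the same
  maximum, the same critical points and indices, and a level `c < max S'.φ`, not a critical
  value, with the index-`0` and index-`1` points in `{S'.φ < c}` and the index-`2` point in
  `{c < S'.φ}`.

On the hypothesis "index-`1` value `≤` index-`2` value": for a *contractible* `W` it is
automatic (were the index-`1` point the top critical point, `W` would be a connected sublevel
set with one `1`-handle attached, so `π₁ W ≠ 1`; Milnor 1965, Thm. 3.14), but that
homotopy-theoretic step is not carried out here; the consumer supplies the inequality.

## References

* J. Milnor, *Lectures on the h-cobordism theorem*, Princeton Math. Notes (1965), §2,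
  Lemma 2.8 (PDF p. 11); §4 (rearrangement of critical values). [MilnorHCobordism1965]
* K. Cieliebak, Ya. Eliashberg, *From Stein to Weinstein and back*, AMS Coll. Publ. 59 (2012),
  §3.2 (`J`-convexity is `C²`-open). [CieliebakEliashberg2012]
* J. Milnor, *Morse theory*, Ann. of Math. Studies 51 (1963), §2–§3. [Milnor1963]
-/


noncomputable section

open scoped Manifold ContDiff Topology
open Set Function Filter Metric

namespace Literature.Geometry.Symplectic

open Literature.Geometry.Kaehler Literature.Topology.FourManifolds

variable {W : Type*} [TopologicalSpace W] [T2Space W] [ChartedSpace (EuclideanHalfSpace 4) W]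
  [IsManifold (𝓡∂ 4) ∞ W] [CompactSpace W]

/-! ### Repackaging and Lemma 2.8 for Stein structures -/

namespace SteinStructure

omit [T2Space W] in
/-- **Repackaging a perturbed `J`-convex function as a Stein structure with the same `J`.**
If `g` is smooth, strictly `J`-convex for `S.J`, agrees with `S.φ` near every boundary point
and is `< max S.φ` at interior points, then `(S.J, g)` is a Stein structure `S'` on `W`
(`S'.J = S.J`, `S'.φ = g`) with `max S'.φ = max S.φ`: the almost complex data and their
axioms are those of `S`; `∂W` is the level `{g = max S.φ} = {g = max g}` (the maximum of
`S.φ` is attained, at a boundary point, where `g = S.φ`), regular because `dg = dS.φ ≠ 0`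
there. [cite: Gompf1998, §1] [cite: CieliebakEliashberg2012, Def. 1.1 ff.] -/
theorem exists_eq_of_levi_pos (S : SteinStructure W) {g : W → ℝ}
    (hg : ContMDiff (𝓡∂ 4) 𝓘(ℝ, ℝ) ∞ g)
    (hconv : ∀ x (v : EuclideanSpace ℝ (Fin 4)), v ≠ 0 →
      0 < -(mextDeriv (dComplex S.J g) x ![v, S.J x v]))
    (hbd : ∀ x, (𝓡∂ 4).IsBoundaryPoint x → g =ᶠ[𝓝 x] S.φ)
    (hint : ∀ x, (𝓡∂ 4).IsInteriorPoint x → g x < sSup (range S.φ)) :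
    ∃ S' : SteinStructure W, S'.J = S.J ∧ S'.φ = g ∧ sSup (range S'.φ) = sSup (range S.φ) := by
  have hle : ∀ y, g y ≤ sSup (range S.φ) := fun y => by
    rcases (𝓡∂ 4).isInteriorPoint_or_isBoundaryPoint y with h | h
    · exact (hint y h).le
    · rw [(hbd y h).self_of_nhds]; exact S.φ_le_sSup y
  have hsup : sSup (range g) = sSup (range S.φ) := by
    rcases isEmpty_or_nonempty W with hW | hW
    · simp [Set.range_eq_empty]
    · obtain ⟨x₀, -, hx₀⟩ :=
        isCompact_univ.exists_isMaxOn univ_nonempty S.φ_smooth.continuous.continuousOn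
      have hM : sSup (range S.φ) = S.φ x₀ :=
        IsGreatest.csSup_eq ⟨mem_range_self x₀, forall_mem_range.2 fun y => hx₀ (mem_univ y)⟩
      have hx₀b : (𝓡∂ 4).IsBoundaryPoint x₀ := (S.boundary_eq x₀).2 hM.symm
      have hgx₀ : g x₀ = sSup (range S.φ) := (hbd x₀ hx₀b).self_of_nhds.trans hM.symm
      exact IsGreatest.csSup_eq ⟨⟨x₀, hgx₀⟩, forall_mem_range.2 hle⟩
  refine ⟨⟨S.J, g, S.J_sq, S.J_smooth, S.integrable, hg, hconv, fun x => ?_, fun x hx => ?_⟩,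
    rfl, rfl, hsup⟩
  · -- the boundary is the maximal level set of `g`
    show (𝓡∂ 4).IsBoundaryPoint x ↔ g x = sSup (range g)
    rw [hsup]
    refine ⟨fun hx => ?_, fun hx => ?_⟩
    · rw [(hbd x hx).self_of_nhds]; exact (S.boundary_eq x).1 hx
    · by_contra hnb
      exact (hint x (((𝓡∂ 4).isInteriorPoint_iff_not_isBoundaryPoint x).2 hnb)).ne hx
  · -- and a regular one
    show mfderiv (𝓡∂ 4) 𝓘(ℝ, ℝ) g x ≠ 0
    rw [(hbd x hx).mfderiv_eq]
    exact S.regular x hx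

/-- **Milnor's Lemma 2.8 for Stein structures: moving one critical value of the `J`-convex
Morse function by an interior `J`-convex perturbation.**  If `S.φ` is Morse and `p` is a
critical point, then for every finite `F ⊆ ℝ` and `η > 0` there is a Stein structure `S'` on
`W` with the same `J`, `S'.φ` Morse with the same critical points and Morse indices as `S.φ`,
`S'.φ = S.φ` at the other critical points and on an open set containing `∂W`,
`max S'.φ = max S.φ`, and `S'.φ p ∉ F`, `S.φ p < S'.φ p < S.φ p + η`
(`exists_perturb_criticalValue_levi` repackaged by `exists_eq_of_levi_pos`).
[cite: MilnorHCobordism1965, Lemma 2.8 (PDF p. 11)]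
[cite: CieliebakEliashberg2012, §3.2 (J-convexity is C²-open)] -/
theorem exists_perturb_criticalValue (S : SteinStructure W) (hM : IsMorse (𝓡∂ 4) S.φ)
    {p : W} (hp : IsMCriticalPt (𝓡∂ 4) S.φ p) {F : Set ℝ} (hF : F.Finite) {η : ℝ} (hη : 0 < η) :
    ∃ S' : SteinStructure W, S'.J = S.J ∧ IsMorse (𝓡∂ 4) S'.φ ∧
      criticalSet (𝓡∂ 4) S'.φ = criticalSet (𝓡∂ 4) S.φ ∧
      (∀ q ∈ criticalSet (𝓡∂ 4) S.φ, morseIndex (𝓡∂ 4) S'.φ q = morseIndex (𝓡∂ 4) S.φ q) ∧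
      (∀ q ∈ criticalSet (𝓡∂ 4) S.φ, q ≠ p → S'.φ q = S.φ q) ∧
      (∃ U : Set W, IsOpen U ∧ (∀ x, (𝓡∂ 4).IsBoundaryPoint x → x ∈ U) ∧ EqOn S'.φ S.φ U) ∧
      sSup (range S'.φ) = sSup (range S.φ) ∧
      S'.φ p ∉ F ∧ S.φ p < S'.φ p ∧ S'.φ p < S.φ p + η := by
  obtain ⟨g, hgM, hcrit, hind, hval, ⟨U, hUo, hbU, hgU⟩, hlt, hconv, hF', hlo, hhi⟩ :=
    exists_perturb_criticalValue_levi S.preservesSmoothFields hM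
      (fun x hx h => S.regular x hx h) (fun x hx => (S.isInteriorPoint_iff_φ_lt x).1 hx)
      (fun x v hv => S.convex x v hv) hp hF hη
  have hbd : ∀ x, (𝓡∂ 4).IsBoundaryPoint x → g =ᶠ[𝓝 x] S.φ := fun x hx => by
    filter_upwards [hUo.mem_nhds (hbU x hx)] with y hy
    exact hgU hy
  obtain ⟨S', hJ', hφ', hsup⟩ := S.exists_eq_of_levi_pos hgM.1 hconv hbd hlt
  subst hφ'
  exact ⟨S', hJ', hgM, hcrit, hind, hval, ⟨U, hUo, hbU, hgU⟩, hsup, hF', hlo, hhi⟩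

/-! ### The separating level -/


/-- **F1a: a regular level separating the index-`2` critical point of a `J`-convex Morse
function with one critical point of each index `0, 1, 2`.**  Let `S` be a Stein structure on
the compact `4`-manifold with boundary `W` whose `J`-convex function `S.φ` is Morse with
exactly one critical point of index `0`, one of index `1` and one of index `2`, the index-`1`
critical value being `≤` the index-`2` critical value (automatic when `W` is contractible: the
top handle of a contractible handlebody is not a `1`-handle).  Then there is a Stein structure
`S'` on `W` with `S'.J = S.J`, `S'.φ = S.φ` on an open set containing `∂W`,
`max S'.φ = max S.φ`, `S'.φ` Morse with the same critical points and the same critical points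
of every index, and a level `c < max S'.φ` which is not a critical value of `S'.φ`, with the
critical points of index `0` and `1` in `{S'.φ < c}` and the critical point of index `2` in
`{c < S'.φ}`.  Proof: every critical point of `S.φ` has index `≤ 2`
(`SteinStructure.morseIndex_le_two_of_isMCriticalPt`), so the critical points are the three
given ones; the index-`0` point is the minimum point of `S.φ` (an interior minimum is critical
of index `0`); push the index-`2` value up by Lemma 2.8 with the `J`-convexity invariant
(`exists_perturb_criticalValue`) and take `c` between its old and new value.
[cite: MilnorHCobordism1965, Lemma 2.8 (PDF p. 11) and §4]
[cite: CieliebakEliashberg2012, §3.2 (J-convexity is C²-open)] -/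
theorem exists_perturb_separating_level (S : SteinStructure W) (hM : IsMorse (𝓡∂ 4) S.φ)
    (h0 : (criticalSetOfIndex (𝓡∂ 4) S.φ 0).ncard = 1)
    (h1 : (criticalSetOfIndex (𝓡∂ 4) S.φ 1).ncard = 1)
    (h2 : (criticalSetOfIndex (𝓡∂ 4) S.φ 2).ncard = 1)
    (hord : ∀ p ∈ criticalSetOfIndex (𝓡∂ 4) S.φ 1, ∀ q ∈ criticalSetOfIndex (𝓡∂ 4) S.φ 2,
      S.φ p ≤ S.φ q) :
    ∃ S' : SteinStructure W, S'.J = S.J ∧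
      (∃ U : Set W, IsOpen U ∧ (∀ x, (𝓡∂ 4).IsBoundaryPoint x → x ∈ U) ∧ EqOn S'.φ S.φ U) ∧
      sSup (range S'.φ) = sSup (range S.φ) ∧
      IsMorse (𝓡∂ 4) S'.φ ∧ criticalSet (𝓡∂ 4) S'.φ = criticalSet (𝓡∂ 4) S.φ ∧
      (∀ k, criticalSetOfIndex (𝓡∂ 4) S'.φ k = criticalSetOfIndex (𝓡∂ 4) S.φ k) ∧
      ∃ c : ℝ, c < sSup (range S'.φ) ∧
        (∀ z, IsMCriticalPt (𝓡∂ 4) S'.φ z → S'.φ z ≠ c) ∧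
        (∀ z ∈ criticalSetOfIndex (𝓡∂ 4) S'.φ 0, S'.φ z < c) ∧
        (∀ z ∈ criticalSetOfIndex (𝓡∂ 4) S'.φ 1, S'.φ z < c) ∧
        (∀ z ∈ criticalSetOfIndex (𝓡∂ 4) S'.φ 2, c < S'.φ z) := by
  classical
  -- the three critical points
  obtain ⟨p₀, hp₀⟩ := Set.ncard_eq_one.1 h0
  obtain ⟨p₁, hp₁⟩ := Set.ncard_eq_one.1 h1
  obtain ⟨p₂, hp₂⟩ := Set.ncard_eq_one.1 h2
  have hp₀m : p₀ ∈ criticalSetOfIndex (𝓡∂ 4) S.φ 0 := by rw [hp₀]; exact mem_singleton p₀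
  have hp₁m : p₁ ∈ criticalSetOfIndex (𝓡∂ 4) S.φ 1 := by rw [hp₁]; exact mem_singleton p₁
  have hp₂m : p₂ ∈ criticalSetOfIndex (𝓡∂ 4) S.φ 2 := by rw [hp₂]; exact mem_singleton p₂
  have h12 : S.φ p₁ ≤ S.φ p₂ := hord p₁ hp₁m p₂ hp₂m
  -- every critical point is one of them
  have hcases : ∀ z, IsMCriticalPt (𝓡∂ 4) S.φ z → z = p₀ ∨ z = p₁ ∨ z = p₂ := by
    intro z hz
    have hle := S.morseIndex_le_two_of_isMCriticalPt hz
    rcases Nat.lt_or_ge (morseIndex (𝓡∂ 4) S.φ z) 1 with h | h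
    · left
      have : z ∈ criticalSetOfIndex (𝓡∂ 4) S.φ 0 := ⟨hz, by omega⟩
      rw [hp₀] at this; exact this
    · rcases Nat.lt_or_ge (morseIndex (𝓡∂ 4) S.φ z) 2 with h' | h'
      · right; left
        have : z ∈ criticalSetOfIndex (𝓡∂ 4) S.φ 1 := ⟨hz, by omega⟩
        rw [hp₁] at this; exact this
      · right; right
        have : z ∈ criticalSetOfIndex (𝓡∂ 4) S.φ 2 := ⟨hz, by omega⟩
        rw [hp₂] at this; exact this
  -- the index-`0` point is the minimum point of `S.φ`
  have h01 : S.φ p₀ ≤ S.φ p₁ := by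
    haveI : Nonempty W := ⟨p₀⟩
    obtain ⟨x₀, -, hx₀⟩ :=
      isCompact_univ.exists_isMinOn univ_nonempty S.φ_smooth.continuous.continuousOn
    have hx₀int : (𝓡∂ 4).IsInteriorPoint x₀ := by
      refine ((𝓡∂ 4).isInteriorPoint_or_isBoundaryPoint x₀).resolve_right fun hb => ?_
      have hmax : S.φ x₀ = sSup (range S.φ) := (S.boundary_eq x₀).1 hb
      have hle : S.φ x₀ ≤ S.φ p₁ := isMinOn_iff.1 hx₀ p₁ (mem_univ p₁)
      have hlt : S.φ p₁ < sSup (range S.φ) := S.φ_lt_sSup_of_isMCriticalPt hp₁m.1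
      linarith
    have hloc : IsLocalMin S.φ x₀ := hx₀.isLocalMin univ_mem
    have hcrit : IsMCriticalPt (𝓡∂ 4) S.φ x₀ := isMCriticalPt_of_isLocalMin hloc hx₀int
    have hidx : morseIndex (𝓡∂ 4) S.φ x₀ = 0 :=
      morseIndex_eq_zero_of_isLocalMin_of_isInteriorPoint
        ((S.φ_smooth x₀).of_le (by norm_cast)) hloc hx₀int
    have hx₀p : x₀ = p₀ := by
      have : x₀ ∈ criticalSetOfIndex (𝓡∂ 4) S.φ 0 := ⟨hcrit, hidx⟩
      rw [hp₀] at this; exact this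
    rw [← hx₀p]
    exact isMinOn_iff.1 hx₀ p₁ (mem_univ p₁)
  -- push the index-`2` value up, keeping `J`, `J`-convexity and the boundary germ
  obtain ⟨S', hJ', hM', hcrit, hind, hval, hU, hsup, -, hlo, -⟩ :=
    S.exists_perturb_criticalValue hM hp₂m.1 finite_empty one_pos
  have hne₁₂ : p₁ ≠ p₂ := fun h => by
    have a := hp₁m.2; have b := hp₂m.2
    rw [h] at a; omega
  have hne₀₂ : p₀ ≠ p₂ := fun h => by
    have a := hp₀m.2; have b := hp₂m.2
    rw [h] at a; omega
  have hv₁ : S'.φ p₁ = S.φ p₁ := hval p₁ hp₁m.1 hne₁₂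
  have hv₀ : S'.φ p₀ = S.φ p₀ := hval p₀ hp₀m.1 hne₀₂
  have hidx : ∀ k, criticalSetOfIndex (𝓡∂ 4) S'.φ k = criticalSetOfIndex (𝓡∂ 4) S.φ k := by
    intro k
    ext z
    simp only [mem_criticalSetOfIndex]
    have hz : IsMCriticalPt (𝓡∂ 4) S'.φ z ↔ IsMCriticalPt (𝓡∂ 4) S.φ z := by
      rw [← mem_criticalSet, ← mem_criticalSet (I := 𝓡∂ 4), hcrit]
    constructor
    · rintro ⟨hz', hk⟩
      exact ⟨hz.1 hz', (hind z (hz.1 hz')).symm.trans hk⟩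
    · rintro ⟨hz', hk⟩
      exact ⟨hz.2 hz', (hind z hz').trans hk⟩
  set c : ℝ := (S.φ p₂ + S'.φ p₂) / 2 with hc
  have hc₂ : c < S'.φ p₂ := by rw [hc]; linarith
  have hc₁ : S'.φ p₁ < c := by rw [hc, hv₁]; linarith
  have hc₀ : S'.φ p₀ < c := by rw [hv₀]; linarith
  have hp₂' : IsMCriticalPt (𝓡∂ 4) S'.φ p₂ := by
    have : p₂ ∈ criticalSet (𝓡∂ 4) S'.φ := by rw [hcrit]; exact hp₂m.1
    exact this
  refine ⟨S', hJ', hU, hsup, hM', hcrit, hidx, c, hc₂.trans (S'.φ_lt_sSup_of_isMCriticalPt hp₂'),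
    fun z hz => ?_, fun z hz => ?_, fun z hz => ?_, fun z hz => ?_⟩
  · have hz' : IsMCriticalPt (𝓡∂ 4) S.φ z := by
      have : z ∈ criticalSet (𝓡∂ 4) S.φ := by rw [← hcrit]; exact hz
      exact this
    rcases hcases z hz' with rfl | rfl | rfl
    · exact hc₀.ne
    · exact hc₁.ne
    · exact hc₂.ne'
  · rw [hidx 0, hp₀] at hz
    rw [mem_singleton_iff.1 hz]; exact hc₀
  · rw [hidx 1, hp₁] at hz
    rw [mem_singleton_iff.1 hz]; exact hc₁
  · rw [hidx 2, hp₂] at hz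
    rw [mem_singleton_iff.1 hz]; exact hc₂

end SteinStructure

end Literature.Geometry.Symplectic

end
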